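import Literature.NumberTheory.EllipticCurves.PeriodIndex
import Literature.NumberTheory.EllipticCurves.PeriodIndexRamifiedExtension
import Mathlib.FieldTheory.PrimitiveElement
import Mathlib.Data.Nat.Factorization.Induction
import HarnessLib

/-!
# Period, index and potential `Ш` — discharges

Sibling proof file of `Literature/NumberTheory/EllipticCurves/PeriodIndex` (D-0014 decomposition of
the named fact `Literature.Barriers.BirchSwinnertonDyer.ClarkSharif2010_thm3`, Clark–Sharif 2010, Theorem 3). Of the five
named parts of the printed proof vendored there, the existence of a degree-`P` extension with
prescribed totally ramified completions (`Literature.NumberTheory.EllipticCurves.ClarkSharif2010_exists_totallyRamified`, §3.7 with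
footnote 3) is PROVED in `PeriodIndexRamifiedExtension` (`Literature.NumberTheory.EllipticCurves.exists_extension_totallyRamified`,
Eisenstein polynomials `X^P + a` with `ord_v(a) = 1`); this file records the discharge
(`ClarkSharif2010_exists_totallyRamified_holds`) and the resulting form of Theorem 3 over a number
field depending only on the four remaining parts — Theorem 2 of the paper, Lang–Tate's splitting
criterion, Cassels' `I = P` on `Ш`, and the finiteness of supports
(`ClarkSharif2010_thm3_of_parts'`).

## Theorem 2 from its prime-power case (the standard trick of §3)

Second instalment (towards the part `Literature.NumberTheory.EllipticCurves.ClarkSharif2010_thm2`,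
Clark–Sharif's **Theorem 2**, the heart of the paper).

What is printed. §3, opening paragraph: "We first remind the reader of a standard trick:
in all work on the period-index problem it suffices to treat the case where the period `P` is a
prime power `P = p^a`. Indeed, if a class `η ∈ H¹(K, E)` (or any other Galois cohomology group,
for that matter) has period `P = p_1^{a_1} ⋯ p_r^{a_r}`, then putting `η_i = (P / p_i^{a_i}) η`,
one easily checks that `η = Σ_{i=1}^r η_i` and that `I(η) = ∏_{i=1}^r I(η_i)` (i.e., the index of
`η` is the product of the indices of the classes `η_i`)."  The printed proof of Theorem 2
(§3.3 preliminaries, §3.4 Lemma 14 choosing pairs of primes by Chebotarev, §3.5 corestrictions: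
Lemma 15, Proposition 16, Corollary 17, Lemmas 18–19, §3.6 conclusion) is written for `P = p^a`
(Lemma 18: "since `P` is a prime power, the order strictly divides `P`").

This part of the file
* proves the splitting-degree arithmetic behind the standard trick for the tree's index
  `Literature.NumberTheory.EllipticCurves.index` (the greatest common divisor of the splitting
  degrees): every common divisor of the splitting degrees divides the index
  (`dvd_index_of_forall_dvd`); from one splitting field `M` of `δ` and one splitting field `N` of
  `ε` one gets common splitting fields of `δ + ε` whose degrees add up to `[M : K] [N : K]`
  (`exists_splittingDegrees_add`: a primitive element of `M/K` with minimal polynomial `f`, and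
  the fields `N[X]/(q)` for the irreducible factors `q` of `f` over `N`); hence
  **`I(δ + ε) = I(δ) I(ε)` for classes `δ`, `ε` which are multiples of `δ + ε` and have coprime
  indices** (`index_add_eq_mul_of_coprime`), which with
  `AddCommute.addOrderOf_add_eq_mul_addOrderOf_of_coprime` is the standard trick;
* **proves the conclusion of Theorem 2 for `(E, S_K, P)` from its prime-power cases
  `(E, S_K, p^n)`, `p^n ∣ P`** (`ClarkSharif2010_thm2Seq_of_primePow`: induction over the
  factorisation of `P` into coprime prime powers, `Nat.recOnPosPrimePosCoprime`, adding the two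
  sequences of classes, `ClarkSharif2010_thm2Seq_mul_of_coprime`), whence
  `ClarkSharif2010_thm2_of_primePow`: Theorem 2 follows from its prime-power case — the statement
  the printed proof establishes.

What remains of `ClarkSharif2010_thm2` is exactly its prime-power case (the hypothesis of
`ClarkSharif2010_thm2_of_primePow`; no new named fact is introduced here, D-0026), whose printed
proof needs, besides the Kummer sequence for `E` (in the tree: `galH1Torsion`, `kummerMapTorsion`
of `Literature/NumberTheory/EllipticCurves/KummerMap`), O'Neil's period-index obstruction map
`Δ_P : H¹(K, E[P]) → Br(K)` (theta groups), `Br(K) = H²(K, K̄^×)` with its local invariants and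
the Hasse principle (Mathlib's `BrauerGroup` is the Morita-class group of central simple algebras,
without these), Lichtenbaum–Tate duality, level-`P` Hilbert symbols over the `P*`-division field,
corestriction, ray class fields and the Chebotarev density theorem (in the tree only as the named
fact `Literature.NumberTheory.Automorphic.chebotarev_artinRep`), none of which is formalised at
present.

## Theorem 2: the period from the index (§3.6)

Third instalment: `ClarkSharif2010_thm2_of_primePow_torsion_index` — in the prime-power case the
period condition of Theorem 2 is automatic once the classes are `p^n`-torsion (they come from
`H¹(K, E[P])`, §3.5) and the pairwise differences have index `p^{2n}`, GIVEN the divisibility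
`I ∣ P²` of §1.3 (1) ([WCII]); both inputs are hypotheses (no new named fact, D-0026). This is the
first paragraph of §3.6 ("Clearly, `P(C) ∣ P`. If we can show that `I(C) = P²`, then by (1) we
must have `P(C) = P`.").

## References

* P. L. Clark, S. Sharif, Algebra Number Theory 4 (2010) 151–174, Theorems 2–3, §3.7; Theorem 2,
  §3 (opening paragraph: the standard trick) and §§3.3–3.6 (`ClarkSharif2010`; arXiv:0811.3019
  read in full).
-/

noncomputable section

open NumberField IsDedekindDomain

universe u

namespace Literature.NumberTheory.EllipticCurves

/-- **Discharge of `Literature.NumberTheory.EllipticCurves.ClarkSharif2010_exists_totallyRamified`**: for a number field `K`, a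
finite set `T` of finite places and `P > 0` there is `L/K` of degree `P` with `e(w|v) = P` for
every place `w` of `L` above every `v ∈ T` — `Literature.NumberTheory.EllipticCurves.exists_extension_totallyRamified`
(`L = K[X]/(X^P + a)`, `ord_v(a) = 1` on `T`). [cite: ClarkSharif2010, §3.7 with footnote 3] -/
theorem ClarkSharif2010_exists_totallyRamified_holds : ClarkSharif2010_exists_totallyRamified.{u} :=
  fun T _ hP ↦ exists_extension_totallyRamified T hP

/-- **Clark–Sharif 2010, Theorem 3 over a number field, from the four remaining parts** (Theorem 2,
Lang–Tate, Cassels, finiteness of supports; the ramified extension being proved): for an elliptic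
curve `E` over a number field `K`, `P > 1` and `r`, there is `L/K` with `[L : K] = P` and `r`
distinct elements of `Ш(E_L/L)` of order exactly `P`. `Literature.NumberTheory.EllipticCurves.ClarkSharif2010_thm3_of_parts` with
`ClarkSharif2010_exists_totallyRamified_holds`. [cite: ClarkSharif2010, Theorem 3 and §3.7] -/
theorem ClarkSharif2010_thm3_of_parts' (h2 : ClarkSharif2010_thm2.{u})
    (hLT : LangTate1958_split_of_dvd_ramificationIdx.{u})
    (hC : Cassels1962_index_eq_period_of_mem_sha.{u}) (hF : finite_support.{u})
    {K : Type u} [Field K] [NumberField K] (W : WeierstrassCurve K) [W.IsElliptic]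
    {P : ℕ} (hP : 1 < P) (r : ℕ) :
    ∃ (L : Type u) (_ : Field L) (_ : NumberField L) (_ : Algebra K L),
      Module.finrank K L = P ∧
        ∃ S : Finset ↥((W.baseChange L).sha), S.card = r ∧ ∀ x ∈ S, addOrderOf x = P :=
  ClarkSharif2010_thm3_of_parts W h2 hLT hC ClarkSharif2010_exists_totallyRamified_holds hF hP r

/-! ### More on splitting degrees and the index -/

section IndexAPI

variable {K : Type u} [Field K] (W : WeierstrassCurve K)

/-- A field splitting `η` splits every multiple `z • η` of `η` (the kernel of restriction is a
subgroup): the splitting degrees of `η` are splitting degrees of `z • η`. Used in the standard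
trick with `η_i = (P / p_i^{a_i}) η`. [cite: ClarkSharif2010, §3 (standard trick)] -/
theorem splittingDegrees_subset_of_zsmul_eq {η θ : W.galH1} {z : ℤ} (h : z • η = θ) :
    splittingDegrees W η ⊆ splittingDegrees W θ := by
  rintro d ⟨M, _, _, _, rfl, hM⟩
  exact ⟨M, inferInstance, inferInstance, inferInstance, rfl, h ▸ AddSubgroup.zsmul_mem _ hM z⟩

/-- A class with nonzero index splits over some finite extension (if there were no splitting
degree, every natural number would be a common divisor and the index would be the junk value
`0`). [folklore] -/
theorem splittingDegrees_nonempty_of_index_ne_zero {η : W.galH1} (h : index W η ≠ 0) :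
    (splittingDegrees W η).Nonempty := by
  by_contra hne
  rw [Set.not_nonempty_iff_eq_empty] at hne
  apply h
  unfold index
  apply Nat.sSup_of_not_bddAbove
  rintro ⟨b, hb⟩
  have hmem : b + 1 ∈ {g : ℕ | ∀ d ∈ splittingDegrees W η, g ∣ d} := fun d hd ↦ by
    rw [hne] at hd
    exact hd.elim
  exact Nat.lt_irrefl b (Nat.lt_of_succ_le (hb hmem))

/-- A class which splits over some finite extension has nonzero index (the common divisors of
the splitting degrees contain `1` and are bounded by any splitting degree). [folklore] -/
theorem index_ne_zero_of_mem_splittingDegrees {η : W.galH1} {d : ℕ}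
    (hd : d ∈ splittingDegrees W η) : index W η ≠ 0 := by
  have hbdd : BddAbove {g : ℕ | ∀ d ∈ splittingDegrees W η, g ∣ d} :=
    ⟨d, fun g hg ↦ Nat.le_of_dvd (pos_of_mem_splittingDegrees hd) (hg d hd)⟩
  have h1 : 1 ≤ index W η := le_csSup hbdd fun _ _ ↦ one_dvd _
  exact Nat.one_le_iff_ne_zero.mp h1

/-- **Every common divisor of the splitting degrees divides the index** (as soon as there is a
splitting degree): the index is the greatest common divisor of the splitting degrees, not only
the greatest among the common divisors (the lcm of the index and a common divisor is again a
common divisor, hence at most the index). [cite: ClarkSharif2010, §1.1] -/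
theorem dvd_index_of_forall_dvd {η : W.galH1} (hne : (splittingDegrees W η).Nonempty) {c : ℕ}
    (hc : ∀ d ∈ splittingDegrees W η, c ∣ d) : c ∣ index W η := by
  obtain ⟨d₀, hd₀⟩ := hne
  have h0 : index W η ≠ 0 := index_ne_zero_of_mem_splittingDegrees W hd₀
  have hc0 : c ≠ 0 := by
    rintro rfl
    exact (pos_of_mem_splittingDegrees hd₀).ne' (Nat.eq_zero_of_zero_dvd (hc d₀ hd₀))
  have hlcm : ∀ d ∈ splittingDegrees W η, Nat.lcm (index W η) c ∣ d := fun d hd ↦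
    Nat.lcm_dvd (index_dvd_of_mem_splittingDegrees W hd) (hc d hd)
  have hle : Nat.lcm (index W η) c ≤ index W η := le_index_of_forall_dvd W h0 hlcm
  have hpos : 0 < Nat.lcm (index W η) c := Nat.pos_of_ne_zero (Nat.lcm_ne_zero h0 hc0)
  have heq : Nat.lcm (index W η) c = index W η :=
    le_antisymm hle (Nat.le_of_dvd hpos (Nat.dvd_lcm_left _ _))
  rw [← heq]
  exact Nat.dvd_lcm_right _ _

/-- Elementary arithmetic of the standard trick: if `g ∣ m · n` for every `m` in a set `D` of
naturals all of whose common divisors divide `a`, and `n > 0`, then `g ∣ a · n` (divide `g` and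
`n` by their gcd). [folklore] -/
theorem dvd_mul_of_forall_dvd_mul {D : Set ℕ} {a g n : ℕ} (hn : 0 < n)
    (hD : ∀ c, (∀ m ∈ D, c ∣ m) → c ∣ a) (hg : ∀ m ∈ D, g ∣ m * n) : g ∣ a * n := by
  obtain ⟨k, g', n', rfl, rfl, hco, hk⟩ :
      ∃ k g' n', g = g' * k ∧ n = n' * k ∧ Nat.Coprime g' n' ∧ 0 < k :=
    ⟨Nat.gcd g n, g / Nat.gcd g n, n / Nat.gcd g n,
      (Nat.div_mul_cancel (Nat.gcd_dvd_left g n)).symm,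
      (Nat.div_mul_cancel (Nat.gcd_dvd_right g n)).symm,
      Nat.coprime_div_gcd_div_gcd (Nat.gcd_pos_of_pos_right g hn), Nat.gcd_pos_of_pos_right g hn⟩
  have h1 : ∀ m ∈ D, g' ∣ m := fun m hm ↦ by
    have h := hg m hm
    rw [← mul_assoc] at h
    exact hco.dvd_of_dvd_mul_right ((Nat.mul_dvd_mul_iff_right hk).mp h)
  exact mul_dvd_mul (hD g' h1) (Nat.dvd_mul_left k n')

end IndexAPI

/-! ### The standard trick: the index is multiplicative over coprime periods -/

section StandardTrick

open scoped Classical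

open Polynomial UniqueFactorizationMonoid

variable {K : Type u} [Field K] [CharZero K] (W : WeierstrassCurve K)

/-- **Common splitting fields from one splitting field each.** Over a field `K` of
characteristic `0`, let `δ ∈ H¹(K, E)` split over the finite extension `M/K` and `ε` over the
finite extension `N/K`. Choose a primitive element of the (separable) extension `M/K`, with
minimal polynomial `f`, `deg f = [M : K]`, and factor `f = ∏ q` into irreducibles over `N`. Each
field `N_q = N[X]/(q)` is a finite extension of `N`, of degree `deg q`, receiving a `K`-embedding
of `M ≅ K[X]/(f)` (`q` has a root there); so both `δ` and `ε`, hence `δ + ε`, split over `N_q`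
(`Literature.NumberTheory.EllipticCurves.localRestrictionKer_le_of_tower`), of degree
`[N : K] · deg q` over `K`, and these degrees add up to `[N : K] · deg f = [M : K] · [N : K]`.
(Equivalently: `M ⊗_K N ≅ ∏_q N_q`.) This is the field theory behind "one easily checks that
`I(η) = ∏ I(η_i)`". [cite: ClarkSharif2010, §3 (standard trick)] -/
theorem exists_splittingDegrees_add {δ ε : W.galH1} (M : Type u) [Field M] [Algebra K M]
    [FiniteDimensional K M] (N : Type u) [Field N] [Algebra K N] [FiniteDimensional K N]
    (hδ : δ ∈ W.localRestrictionKer M) (hε : ε ∈ W.localRestrictionKer N) :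
    ∃ s : Multiset ℕ, s ≠ 0 ∧ (∀ d ∈ s, d ∈ splittingDegrees W (δ + ε)) ∧
      s.sum = Module.finrank K M * Module.finrank K N := by
  -- a primitive element of `M/K` (separable: characteristic `0`), its minimal polynomial `f`,
  -- and `g = f` viewed over `N`
  let pb := Field.powerBasisOfFiniteOfSeparable K M
  have hf : (minpoly K pb.gen).Monic := minpoly.monic pb.isIntegral_gen
  set g : N[X] := (minpoly K pb.gen).map (algebraMap K N) with hg_def
  have hg : g.Monic := hf.map _
  have hg0 : g ≠ 0 := hg.ne_zero
  have hgdeg : g.natDegree = Module.finrank K M := by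
    rw [hg_def, hf.natDegree_map, PowerBasis.natDegree_minpoly, pb.finrank]
  refine ⟨(normalizedFactors g).map fun q ↦ Module.finrank K N * q.natDegree, ?_, ?_, ?_⟩
  · -- `g` has an irreducible factor: it is not a unit, being of degree `[M : K] ≥ 1`
    intro hs
    rw [Multiset.map_eq_zero] at hs
    have hassoc := prod_normalizedFactors hg0
    rw [hs, Multiset.prod_zero] at hassoc
    have hdeg0 : g.natDegree = 0 :=
      natDegree_eq_zero_of_isUnit (associated_one_iff_isUnit.mp hassoc.symm)
    rw [hgdeg] at hdeg0
    exact (Module.finrank_pos (R := K) (M := M)).ne' hdeg0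
  · -- each irreducible factor `q` of `g` gives the common splitting field `N[X]/(q)`
    intro d hd
    obtain ⟨q, hq, rfl⟩ := Multiset.mem_map.mp hd
    haveI : Fact (Irreducible q) := ⟨irreducible_of_normalized_factor q hq⟩
    have hq0 : q ≠ 0 := (irreducible_of_normalized_factor q hq).ne_zero
    haveI : Module.Finite N (AdjoinRoot q) := (AdjoinRoot.powerBasis hq0).finite
    haveI : FiniteDimensional K (AdjoinRoot q) := Module.Finite.trans N (AdjoinRoot q)
    have hroot : aeval (AdjoinRoot.root q) (minpoly K pb.gen) = 0 := by
      rw [AdjoinRoot.aeval_eq_of_algebra, AdjoinRoot.mk_eq_zero, ← hg_def]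
      exact dvd_of_mem_normalizedFactors hq
    let φ : M →ₐ[K] AdjoinRoot q := pb.lift (AdjoinRoot.root q) hroot
    refine ⟨AdjoinRoot q, inferInstance, inferInstance, inferInstance, ?_, add_mem ?_ ?_⟩
    · rw [← Module.finrank_mul_finrank K N (AdjoinRoot q),
        PowerBasis.finrank (AdjoinRoot.powerBasis hq0), AdjoinRoot.powerBasis_dim]
    · letI : Algebra M (AdjoinRoot q) := φ.toRingHom.toAlgebra
      haveI : IsScalarTower K M (AdjoinRoot q) :=
        IsScalarTower.of_algebraMap_eq fun x ↦ (φ.commutes x).symm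
      exact localRestrictionKer_le_of_tower W hδ
    · exact localRestrictionKer_le_of_tower W hε
  · -- the degrees add up to `[N : K] · deg g = [M : K] · [N : K]`
    rw [Multiset.sum_map_mul_left, ← natDegree_multiset_prod _ (zero_notMem_normalizedFactors g),
      natDegree_eq_of_degree_eq (degree_eq_degree_of_associated (prod_normalizedFactors hg0)),
      hgdeg, mul_comm]

/-- **The standard trick: the index is multiplicative** (Clark–Sharif, §3: "putting
`η_i = (P / p_i^{a_i}) η`, one easily checks that `η = Σ η_i` and that `I(η) = ∏ I(η_i)` (i.e.,
the index of `η` is the product of the indices of the classes `η_i`)"). Formal statement, for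
two summands over a field of characteristic `0`: if `δ` and `ε` are both multiples of `δ + ε`
(so that every field splitting `δ + ε` splits `δ` and `ε`; this holds when `δ`, `ε` are killed
by coprime integers) and have nonzero coprime indices, then `I(δ + ε) = I(δ) · I(ε)`. Proof:
`I(δ) I(ε)` divides every splitting degree of `δ + ε` (coprimality), hence divides `I(δ + ε)`
(`dvd_index_of_forall_dvd`); conversely `I(δ + ε) ∣ [M : K] [N : K]` for all splitting fields
`M` of `δ` and `N` of `ε` (`exists_splittingDegrees_add`), hence `I(δ + ε) ∣ I(δ) [N : K]` and
then `I(δ + ε) ∣ I(δ) I(ε)` (`dvd_mul_of_forall_dvd_mul` twice).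
[cite: ClarkSharif2010, §3 (standard trick)] -/
theorem index_add_eq_mul_of_coprime {δ ε : W.galH1} (ha : index W δ ≠ 0) (hb : index W ε ≠ 0)
    (hab : (index W δ).Coprime (index W ε))
    (hδ : splittingDegrees W (δ + ε) ⊆ splittingDegrees W δ)
    (hε : splittingDegrees W (δ + ε) ⊆ splittingDegrees W ε) :
    index W (δ + ε) = index W δ * index W ε := by
  obtain ⟨m₀, hm₀⟩ := splittingDegrees_nonempty_of_index_ne_zero W ha
  obtain ⟨n₀, hn₀⟩ := splittingDegrees_nonempty_of_index_ne_zero W hb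
  -- from one splitting field each: common splitting fields with controlled degrees
  have key : ∀ m ∈ splittingDegrees W δ, ∀ n ∈ splittingDegrees W ε,
      index W (δ + ε) ∣ m * n ∧ (splittingDegrees W (δ + ε)).Nonempty := by
    rintro m ⟨M, _, _, _, rfl, hM⟩ n ⟨N, _, _, _, rfl, hN⟩
    obtain ⟨s, hs0, hs, hsum⟩ := exists_splittingDegrees_add W M N hM hN
    obtain ⟨d, hd⟩ := Multiset.exists_mem_of_ne_zero hs0
    exact ⟨hsum ▸ Multiset.dvd_sum fun d hd ↦ index_dvd_of_mem_splittingDegrees W (hs d hd),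
      ⟨d, hs d hd⟩⟩
  have hne : (splittingDegrees W (δ + ε)).Nonempty := (key m₀ hm₀ n₀ hn₀).2
  apply Nat.dvd_antisymm
  · -- `I(δ + ε) ∣ I(δ) I(ε)`
    have h1 : ∀ n ∈ splittingDegrees W ε, index W (δ + ε) ∣ index W δ * n := fun n hn ↦
      dvd_mul_of_forall_dvd_mul (pos_of_mem_splittingDegrees hn)
        (fun c hc ↦ dvd_index_of_forall_dvd W ⟨m₀, hm₀⟩ hc) fun m hm ↦ (key m hm n hn).1
    have h2 : index W (δ + ε) ∣ index W ε * index W δ :=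
      dvd_mul_of_forall_dvd_mul (Nat.pos_of_ne_zero ha)
        (fun c hc ↦ dvd_index_of_forall_dvd W ⟨n₀, hn₀⟩ hc) fun n hn ↦ by
          rw [mul_comm]
          exact h1 n hn
    rwa [mul_comm] at h2
  · -- `I(δ) I(ε) ∣ I(δ + ε)`
    exact dvd_index_of_forall_dvd W hne fun d hd ↦
      hab.mul_dvd_of_dvd_of_dvd (index_dvd_of_mem_splittingDegrees W (hδ hd))
        (index_dvd_of_mem_splittingDegrees W (hε hd))

end StandardTrick

/-! ### Theorem 2 from its prime-power case -/

section Thm2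

variable {K : Type u} [Field K] [NumberField K] (W : WeierstrassCurve K)
  (S : Finset (HeightOneSpectrum (𝓞 K))) (T : Finset (InfinitePlace K))

/-- **The standard trick for Theorem 2: coprime periods multiply.** The conclusion of Theorem 2
for `(E, S_K, P)` — "There exists an infinite sequence `{η_i}_{i=0}^∞` of elements of `H¹(K, E)`
such that: `η_0 = 0`. For all `v ∈ S_K` and all `i ∈ ℕ`, `res_v η_i = 0`. For all `i, j ∈ ℕ`
with `i ≠ j`, `η_i - η_j` has period `P` and index `P²`", spelled as in
`Literature.NumberTheory.EllipticCurves.ClarkSharif2010_thm2` (`S_K = S ∪ T`) — for `(E, S_K, a)`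
and for `(E, S_K, b)` with `a, b > 0` coprime, with sequences `η¹` and `η²`, implies it for
`(E, S_K, ab)` with the sequence `η¹ + η²`: local triviality above `S_K` is kept (kernels are
subgroups) and, for `i ≠ j`, with `δ = η¹_i - η¹_j`, `ε = η²_i - η²_j`, the class `δ + ε` has
period `ab` (`AddCommute.addOrderOf_add_eq_mul_addOrderOf_of_coprime`) and index
`a² b² = (ab)²` (`index_add_eq_mul_of_coprime`; `δ = v b · (δ + ε)` and `ε = u a · (δ + ε)`
for `u a + v b = 1`, as `a δ = 0 = b ε`). [cite: ClarkSharif2010, §3 (standard trick)] -/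
theorem ClarkSharif2010_thm2Seq_mul_of_coprime {a b : ℕ} (ha : 0 < a) (hb : 0 < b)
    (hab : a.Coprime b)
    (h₁ : ∃ η : ℕ → W.galH1, η 0 = 0 ∧
        (∀ i, ∀ v ∈ S, η i ∈ W.localRestrictionKer (v.adicCompletion K)) ∧
        (∀ i, ∀ w ∈ T, η i ∈ W.localRestrictionKer w.Completion) ∧
        ∀ i j, i ≠ j → addOrderOf (η i - η j) = a ∧ index W (η i - η j) = a ^ 2)
    (h₂ : ∃ η : ℕ → W.galH1, η 0 = 0 ∧
        (∀ i, ∀ v ∈ S, η i ∈ W.localRestrictionKer (v.adicCompletion K)) ∧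
        (∀ i, ∀ w ∈ T, η i ∈ W.localRestrictionKer w.Completion) ∧
        ∀ i j, i ≠ j → addOrderOf (η i - η j) = b ∧ index W (η i - η j) = b ^ 2) :
    ∃ η : ℕ → W.galH1, η 0 = 0 ∧
      (∀ i, ∀ v ∈ S, η i ∈ W.localRestrictionKer (v.adicCompletion K)) ∧
      (∀ i, ∀ w ∈ T, η i ∈ W.localRestrictionKer w.Completion) ∧
      ∀ i j, i ≠ j →
        addOrderOf (η i - η j) = a * b ∧ index W (η i - η j) = (a * b) ^ 2 := by
  obtain ⟨η₁, h₁0, h₁S, h₁T, h₁P⟩ := h₁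
  obtain ⟨η₂, h₂0, h₂S, h₂T, h₂P⟩ := h₂
  refine ⟨fun i ↦ η₁ i + η₂ i, ?_, fun i v hv ↦ add_mem (h₁S i v hv) (h₂S i v hv),
    fun i w hw ↦ add_mem (h₁T i w hw) (h₂T i w hw), fun i j hij ↦ ?_⟩
  · show η₁ 0 + η₂ 0 = 0
    rw [h₁0, h₂0, add_zero]
  · obtain ⟨hδP, hδI⟩ := h₁P i j hij
    obtain ⟨hεP, hεI⟩ := h₂P i j hij
    show addOrderOf (η₁ i + η₂ i - (η₁ j + η₂ j)) = a * b ∧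
      index W (η₁ i + η₂ i - (η₁ j + η₂ j)) = (a * b) ^ 2
    rw [add_sub_add_comm]
    set δ := η₁ i - η₁ j with hδdef
    set ε := η₂ i - η₂ j with hεdef
    -- `δ` and `ε` are multiples of `δ + ε`: `u a + v b = 1`, `a δ = 0`, `b ε = 0`
    obtain ⟨u, v, huv⟩ := Nat.isCoprime_iff_coprime.mpr hab
    have hδa : (a : ℤ) • δ = 0 := by
      rw [natCast_zsmul, ← hδP]
      exact addOrderOf_nsmul_eq_zero δ
    have hεb : (b : ℤ) • ε = 0 := by
      rw [natCast_zsmul, ← hεP]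
      exact addOrderOf_nsmul_eq_zero ε
    have hvb : v * (b : ℤ) = 1 - u * a := by linear_combination huv
    have hua : u * (a : ℤ) = 1 - v * b := by linear_combination huv
    have hδm : (v * (b : ℤ)) • (δ + ε) = δ := by
      have h1 : (v * (b : ℤ)) • ε = 0 := by rw [mul_zsmul, hεb, zsmul_zero]
      have h2 : (v * (b : ℤ)) • δ = δ := by
        simp only [hvb, sub_zsmul, one_zsmul, mul_zsmul, hδa, zsmul_zero, neg_zero, add_zero]
      rw [zsmul_add, h1, h2, add_zero]
    have hεm : (u * (a : ℤ)) • (δ + ε) = ε := by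
      have h1 : (u * (a : ℤ)) • δ = 0 := by rw [mul_zsmul, hδa, zsmul_zero]
      have h2 : (u * (a : ℤ)) • ε = ε := by
        simp only [hua, sub_zsmul, one_zsmul, mul_zsmul, hεb, zsmul_zero, neg_zero, add_zero]
      rw [zsmul_add, h1, h2, zero_add]
    refine ⟨?_, ?_⟩
    · -- period: orders `a`, `b` coprime
      rw [(AddCommute.all δ ε).addOrderOf_add_eq_mul_addOrderOf_of_coprime
        (by rwa [hδP, hεP]), hδP, hεP]
    · -- index: the standard trick
      have ha2 : index W δ ≠ 0 := by
        rw [hδI]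
        exact pow_ne_zero 2 ha.ne'
      have hb2 : index W ε ≠ 0 := by
        rw [hεI]
        exact pow_ne_zero 2 hb.ne'
      have hco : (index W δ).Coprime (index W ε) := by
        rw [hδI, hεI]
        exact hab.pow 2 2
      rw [index_add_eq_mul_of_coprime W ha2 hb2 hco (splittingDegrees_subset_of_zsmul_eq W hδm)
        (splittingDegrees_subset_of_zsmul_eq W hεm), hδI, hεI, mul_pow]

/-- **Theorem 2 for `(E, S_K, P)` from its prime-power cases `(E, S_K, p^n)`, `p^n ∣ P`** (the
standard trick of §3: "it suffices to treat the case where the period `P` is a prime power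
`P = p^a`"): induction over the factorisation of `P` into pairwise coprime prime powers
(`Nat.recOnPosPrimePosCoprime`); `P = 1`: the zero sequence (`I(0) = 1`,
`Literature.NumberTheory.EllipticCurves.index_zero`); coprime factors:
`ClarkSharif2010_thm2Seq_mul_of_coprime`. [cite: ClarkSharif2010, Theorem 2 and §3 (standard trick)] -/
theorem ClarkSharif2010_thm2Seq_of_primePow {P : ℕ} (hP : 0 < P)
    (h : ∀ p n : ℕ, p.Prime → 0 < n → p ^ n ∣ P →
      ∃ η : ℕ → W.galH1, η 0 = 0 ∧
        (∀ i, ∀ v ∈ S, η i ∈ W.localRestrictionKer (v.adicCompletion K)) ∧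
        (∀ i, ∀ w ∈ T, η i ∈ W.localRestrictionKer w.Completion) ∧
        ∀ i j, i ≠ j → addOrderOf (η i - η j) = p ^ n ∧ index W (η i - η j) = (p ^ n) ^ 2) :
    ∃ η : ℕ → W.galH1, η 0 = 0 ∧
      (∀ i, ∀ v ∈ S, η i ∈ W.localRestrictionKer (v.adicCompletion K)) ∧
      (∀ i, ∀ w ∈ T, η i ∈ W.localRestrictionKer w.Completion) ∧
      ∀ i j, i ≠ j → addOrderOf (η i - η j) = P ∧ index W (η i - η j) = P ^ 2 := by
  suffices key : ∀ m : ℕ, m ∣ P → 0 < m →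
      ∃ η : ℕ → W.galH1, η 0 = 0 ∧
        (∀ i, ∀ v ∈ S, η i ∈ W.localRestrictionKer (v.adicCompletion K)) ∧
        (∀ i, ∀ w ∈ T, η i ∈ W.localRestrictionKer w.Completion) ∧
        ∀ i j, i ≠ j → addOrderOf (η i - η j) = m ∧ index W (η i - η j) = m ^ 2 from
    key P dvd_rfl hP
  intro m
  induction m using Nat.recOnPosPrimePosCoprime with
  | prime_pow p n hp hn => exact fun hd _ ↦ h p n hp hn hd
  | zero => exact fun _ h0 ↦ absurd h0 (lt_irrefl 0)
  | one =>
    refine fun _ _ ↦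
      ⟨fun _ ↦ 0, rfl, fun _ _ _ ↦ zero_mem _, fun _ _ _ ↦ zero_mem _, fun i j _ ↦ ?_⟩
    simp only [sub_zero, addOrderOf_zero, index_zero, one_pow, and_self]
  | coprime a b ha hb hab iha ihb =>
    exact fun hd _ ↦ ClarkSharif2010_thm2Seq_mul_of_coprime W S T (zero_lt_one.trans ha)
      (zero_lt_one.trans hb) hab (iha (dvd_of_mul_right_dvd hd) (zero_lt_one.trans ha))
      (ihb (dvd_of_mul_left_dvd hd) (zero_lt_one.trans hb))

end Thm2

/-- **Clark–Sharif 2010, Theorem 2, from its prime-power case** — the case the printed proof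
treats (§3: "it suffices to treat the case where the period `P` is a prime power `P = p^a`";
§§3.3–3.6: the `P*`-division field `K_P = K(E[P*])`, pairs of primes `v_i, v_i'` of `K_P` chosen
inductively by the Chebotarev density theorem (Lemma 14, conditions (SC1′)–(SC5′)), classes
`θ_n = Φ(π_n, π_n')` or `Φ(π_n, 1)` in `H¹(K_P, E[P]) ≅ (K_P^× / K_P^{×P})²`, `ξ_n = cores θ_n`,
`η_n` the image of `ξ_n` in `H¹(K, E)`; `res ∘ cores = Nm` (Lemma 15), the twisted Galois
action (Proposition 16, Corollary 17), Hilbert-symbol computations (Lemmas 18–19: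
`Δ_P(res(ξ_m - ξ_n))` has order `P` at `v_m`, "since `P` is a prime power"), and §3.6: index
`P²` via O'Neil's obstruction map, `Δ_{PD} ∘ j = D Δ_P` (Proposition 6), Lichtenbaum–Tate
duality (Theorem 5) and (SC2′); period `P` from `P ∣ I ∣ P²`; local triviality at `S_K` from
the proof of Theorem 1 and corestriction). If that case holds for every elliptic curve over
every number field, every prime power `p^n` (`n ≥ 1`) and every finite set of places, then so
does `Literature.NumberTheory.EllipticCurves.ClarkSharif2010_thm2`
(`ClarkSharif2010_thm2Seq_of_primePow` curve by curve). The hypothesis is what remains to be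
formalised of Theorem 2; beyond the Kummer sequence its printed proof needs O'Neil's
period-index obstruction map `Δ_P : H¹(K, E[P]) → Br(K)`, local invariants and the Hasse
principle for `Br(K)`, Lichtenbaum–Tate duality, level-`P` Hilbert symbols, corestriction, ray
class fields and the Chebotarev density theorem.
[cite: ClarkSharif2010, Theorem 2, §3 and §§3.3–3.6] -/
theorem ClarkSharif2010_thm2_of_primePow
    (h : ∀ {K : Type u} [Field K] [NumberField K] (W : WeierstrassCurve K) [W.IsElliptic]
      (p n : ℕ), p.Prime → 0 < n →
        ∀ (S : Finset (HeightOneSpectrum (𝓞 K))) (T : Finset (InfinitePlace K)),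
          ∃ η : ℕ → W.galH1, η 0 = 0 ∧
            (∀ i, ∀ v ∈ S, η i ∈ W.localRestrictionKer (v.adicCompletion K)) ∧
            (∀ i, ∀ w ∈ T, η i ∈ W.localRestrictionKer w.Completion) ∧
            ∀ i j, i ≠ j →
              addOrderOf (η i - η j) = p ^ n ∧ index W (η i - η j) = (p ^ n) ^ 2) :
    ClarkSharif2010_thm2.{u} :=
  fun W _ _ hP S T ↦
    ClarkSharif2010_thm2Seq_of_primePow W S T hP fun p n hp hn _ ↦ h W p n hp hn S T

/-- **Clark–Sharif 2010, Theorem 2: the period from the index (§3.6, first paragraph).**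
Printed: "Let `C` be the curve represented by the class `ξ := ξ_i - ξ_j` for some `i ≠ j`.
Clearly, `P(C) ∣ P`. If we can show that `I(C) = P²`, then by (1) we must have `P(C) = P`",
where (1) is the divisibility "`P ∣ I ∣ P²`" of §1.3 ("It is well known (e.g, [WCII]) that the
period `P` and the index `I` of `C` satisfy the divisibilities `P ∣ I ∣ P²`"), and `P(C) ∣ P`
because `ξ_i = cores θ_i` lies in `H¹(K, E[P])` (§3.5), whose image in `H¹(K, E)` is killed by
`P`.  Formally: Theorem 2 follows from (i) the divisibility `I ∣ P²` of §1.3 (1) for classes in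
`H¹(K, E)` of elliptic curves over number fields, and (ii) the prime-power case `P = p^n` of
Theorem 2 with the period condition REPLACED by `p^n • ξ_i = 0` for all `i` — a sequence of
`p^n`-torsion classes with `ξ_0 = 0`, locally trivial at the prescribed places, whose pairwise
differences have index `p^{2n}` (what §§3.3–3.6 construct: index `P²` by Lemma 19,
Proposition 6 and Lichtenbaum–Tate duality; local triviality by the proof of Theorem 1 and
corestriction).  Indeed `addOrderOf (ξ_i - ξ_j) ∣ p^n`, and `p^{2n} = I(ξ_i - ξ_j) ∣
addOrderOf (ξ_i - ξ_j)²` gives `p^n ∣ addOrderOf (ξ_i - ξ_j)`; then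
`ClarkSharif2010_thm2_of_primePow`.  (No new named fact: both inputs are hypotheses, D-0026.)
[cite: ClarkSharif2010, §3.6 (first paragraph) with §1.3 (1) and §3.5] -/
theorem ClarkSharif2010_thm2_of_primePow_torsion_index
    (hIP : ∀ {K : Type u} [Field K] [NumberField K] (W : WeierstrassCurve K) [W.IsElliptic]
      (η : W.galH1), index W η ∣ addOrderOf η ^ 2)
    (h : ∀ {K : Type u} [Field K] [NumberField K] (W : WeierstrassCurve K) [W.IsElliptic]
      (p n : ℕ), p.Prime → 0 < n →
        ∀ (S : Finset (HeightOneSpectrum (𝓞 K))) (T : Finset (InfinitePlace K)),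
          ∃ ξ : ℕ → W.galH1, ξ 0 = 0 ∧ (∀ i, p ^ n • ξ i = 0) ∧
            (∀ i, ∀ v ∈ S, ξ i ∈ W.localRestrictionKer (v.adicCompletion K)) ∧
            (∀ i, ∀ w ∈ T, ξ i ∈ W.localRestrictionKer w.Completion) ∧
            ∀ i j, i ≠ j → index W (ξ i - ξ j) = (p ^ n) ^ 2) :
    ClarkSharif2010_thm2.{u} := by
  refine ClarkSharif2010_thm2_of_primePow fun W _ p n hp hn S T ↦ ?_
  obtain ⟨ξ, h0, htor, hS, hT, hI⟩ := h W p n hp hn S T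
  refine ⟨ξ, h0, hS, hT, fun i j hij ↦ ⟨Nat.dvd_antisymm ?_ ?_, hI i j hij⟩⟩
  · -- `P(C) ∣ P`: the classes are `p^n`-torsion
    exact addOrderOf_dvd_of_nsmul_eq_zero (by rw [smul_sub, htor, htor, sub_zero])
  · -- `P² = I(C) ∣ P(C)²` forces `P ∣ P(C)`
    have hsq : (p ^ n) ^ 2 ∣ addOrderOf (ξ i - ξ j) ^ 2 := hI i j hij ▸ hIP W (ξ i - ξ j)
    exact (Nat.pow_dvd_pow_iff two_ne_zero).mp hsq

end Literature.NumberTheory.EllipticCurves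

end
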